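import Summits.Ventures.PercRepro.S2DichotomyTools

/-!
# PercRepro — S2: THE CONCENTRATED CASE IS A FLAT (p7, gen 11; sub-claim S2; the flat count's second lemma)

In case `k` of the nested dichotomy — a set `W` of nullity `k` on `≤ 5 + k` points and no set of nullity `k + 1` on `≤ 6 + k` points —
the set `W` is a FLAT: a point `x ∈ cl(W) ∖ W` would make `W ∪ {x}` a set of nullity `k + 1` on `≤ 6 + k` points
(**`closure_eq_self_of_not_nullity_succ`**). Consequently a rank-`5` set `B` with a point outside `W` has `ρ(B ∩ W) ≤ 4`: if
`ρ(B ∩ W) = ρ(B)` then `B ⊆ cl(B) = cl(B ∩ W) ⊆ cl(W) = W` (**`eRk_inter_le_four_of_diff_nonempty`**). These are the two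
structural facts of the FLAT COUNT of S2 v33 §R3⁗(r)(5)(b); the size bound `|cl(B)| ≤ 5 + k` is the kit's
`ncard_le_of_eRk_le_of_not_nullity` at `cl(B)`. Axioms: standard.
-/

open scoped Matroid

namespace PercRepro

namespace S2

variable {α : Type}

/-- **The concentrated set is a flat**: `W ⊆ E` of nullity `k` on `≤ 5 + k` points, and no set of nullity `k + 1` on `≤ 6 + k`
points, then `cl(W) = W`. -/
theorem closure_eq_self_of_not_nullity_succ (M : Matroid α) [M.Finite] (k : ℕ) {W : Set α} (hW : W ⊆ M.E)
    (hWk : W.encard = M.eRk W + k) (hw : W.ncard ≤ 5 + k)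
    (hns : ¬ ∃ W' ⊆ M.E, W'.ncard ≤ 6 + k ∧ W'.encard = M.eRk W' + (k + 1)) : M.closure W = W := by
  classical
  by_contra hne
  have hsub : W ⊆ M.closure W := M.subset_closure W hW
  obtain ⟨x, hxcl, hxW⟩ : ∃ x, x ∈ M.closure W ∧ x ∉ W := by
    by_contra h
    push Not at h
    exact hne (Set.Subset.antisymm h hsub)
  have hWfin : W.Finite := M.ground_finite.subset hW
  refine hns ⟨insert x W, Set.insert_subset (M.closure_subset_ground W hxcl) hW, ?_, ?_⟩
  · rw [Set.ncard_insert_of_notMem hxW hWfin]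
    omega
  · have hr : M.eRk (insert x W) = M.eRk W := by
      rw [← M.eRk_closure_eq (insert x W), Matroid.closure_insert_eq_of_mem_closure hxcl, M.eRk_closure_eq]
    rw [Set.encard_insert_of_notMem hxW, hWk, hr]
    ring

/-- **A rank-`5` set leaving a flat `W` meets it in rank `≤ 4`**: `cl(W) = W`, `B ⊆ E`, `ρ(B) = 5`, `B ∖ W ≠ ∅` ⇒ `ρ(B ∩ W) ≤ 4`. -/
theorem eRk_inter_le_four_of_diff_nonempty (M : Matroid α) [M.Finite] {W B : Set α} (hWcl : M.closure W = W)
    (hB : B ⊆ M.E) (hB5 : M.eRk B = 5) (hne : (B \ W).Nonempty) : M.eRk (B ∩ W) ≤ 4 := by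
  by_contra h
  push Not at h
  have h5 : M.eRk B ≤ M.eRk (B ∩ W) := by
    rw [hB5]
    exact Order.add_one_le_of_lt h
  have hfin : M.IsRkFinite (B ∩ W) := M.isRkFinite_of_finite (M.ground_finite.subset (Set.inter_subset_left.trans hB))
  have hcl : M.closure (B ∩ W) = M.closure B :=
    hfin.closure_eq_closure_of_subset_of_eRk_ge_eRk Set.inter_subset_left h5
  obtain ⟨x, hxB, hxW⟩ := hne
  have hx : x ∈ M.closure B := M.subset_closure B hB hxB
  rw [← hcl] at hx
  have hx' : x ∈ M.closure W := M.closure_subset_closure Set.inter_subset_right hx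
  rw [hWcl] at hx'
  exact hxW hx'

end S2

end PercRepro
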